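import Summits.HubbardSuperconductivity.HubbardSuperconductivity.Theorems.BalabanIRBirGappedPhaseReductionTorusZeroModeWeight
import Summits.HubbardSuperconductivity.HubbardSuperconductivity.Theorems.BalabanIRBirGappedPhaseReductionSymbolBlockGibbsWeight
import HarnessLib

/-!
# Route BalabanIR — crux 4 `BirGappedPhaseReduction` / 4R (items `stmt-HubbardSuperconductivity-2082`, `…-14846`):
# zero-mode temporal coercivity of the BdG torus reference AT THE FOCK LEVEL (capstone)

The last link of the chain Trotter determinant (`Literature/…/BdGBondHamiltonianTrotterDeterminant`,
`…/BdGZeroModeTrotterDeterminant`) → de Gennes block form → plane-wave modes (`…TorusModes`,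
`…TorusZeroModeWeight`) → per-mode two-state coercivity (`…TwoStateDeterminant`, `…TemporalModes`) →
explicit symbol-block data (`…SymbolBlockGibbsWeight`), stated on the MANY-BODY TRACE of the route's
reference. For a relabelling `e : Λ ≃ (ℤ/L)²` of the Jordan–Wigner sites, even translation-invariant
hopping `η` and gap data `Δv` with real shifted hopping symbol, a step `a`, and a closed history of
GLOBAL pair phases over an EVEN number `2n+2` of imaginary-time slices (`t + 1` cyclic; `Even M` is
also what crux 2R asks):

* `norm_trace_prod_gibbsWeight_bdgTorus_phase_le` — for ANY admissible family `κ_k ≥ 0`,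
  `‖Tr ∏_t e^{-aH_BdG(η, e^{iθ_t}Δ, μ)}‖ ≤ |e^{-a(2n+2)|Λ|(η 0 - μ)}| · ∏_k [1 + |det Ĝ_k|^{2n+2} + e^{-(κ_k/2) Σ_t (1 - cos(θ_{t+1} - θ_t))} tr (Ĝ_k²)^{n+1}]`;
* **`exists_coercive_norm_trace_prod_gibbsWeight_bdgTorus_phase_le`** — for `a ≠ 0` ONE family
  `κ_k ≥ 0`, `κ_k > 0` at every mode with `Δ̂ k ≠ 0`, independent of `n` and of the history, with
  `‖Tr ∏_t e^{-aH_BdG(θ_t)}‖ ≤ |e^{-a(2n+2)|Λ|(η 0 - μ)}| · ∏_k [2 + e^{-(κ_k/2) Σ_t (1 - cos(θ_{t+1} - θ_t))} tr (Ĝ_k²)^{n+1}]`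
  (`det Ĝ_k = det e^{-ah_k} = 1`: `det_gaugeFix_eq`, `det_gibbsWeight_symbolBlock_eq_one`).

Reading: at `θ ≡ const` the `k`-th factor is EXACTLY `2 + tr G_k^{2n+2}` (empty/broken pair `2`, pair
sector `tr G_k^{2n+2} = 2cosh((2n+2)aE_k)`), so the ratio to the aligned history is at most
`∏_k [p_k + (1 - p_k) e^{-(κ_k/2) S(θ)}]`, `S(θ) = Σ_t (1 - cos(θ_{t+1} - θ_t))`, `p_k → 0` as the number
of slices grows: the fermionic weight of a zero-mode phase history pays `e^{-(Σ_k κ_k/2)·S(θ)}`, an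
EXTENSIVE (`∝ |Λ|`) temporal stiffness — the temporal half of hypothesis (C) of crux 2R for the
reference weight in the zero spatial mode, uniformly in the number of slices. Bookkeeping on the way:
`ofFn_eq_flatten_pairs`, `sum_map_pairs_eq_sum`, `prod_ofFn_eq_prod_map_pairs` (regrouping an even
history in consecutive pairs), `sum_sub_cyclic_eq_zero`.

`Theses`-free, no definitions; `--supports` the crux. [folklore]
-/

noncomputable section

namespace Summit.HubbardSuperconductivity.HubbardSuperconductivity.Theorems

namespace BirBdG

open Matrix NormedSpace Literature.Probability.LatticeModels Literature.MathematicalPhysics.QuantumLattice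
open scoped ComplexConjugate ComplexOrder

section ZeroModeCoercivity

/-- An even-length `List.ofFn`, cut into consecutive pairs. [folklore] -/
theorem ofFn_eq_flatten_pairs {α : Type*} {n : ℕ} (f : Fin (2 * n + 2) → α) :
    List.ofFn f = (List.ofFn fun s : Fin (n + 1) =>
        [f ⟨2 * (s : ℕ), by omega⟩, f ⟨2 * (s : ℕ) + 1, by omega⟩]).flatten := by
  rw [List.ofFn_congr (show 2 * n + 2 = 2 * (n + 1) by ring) f, List.ofFn_mul']
  refine congrArg List.flatten (congrArg List.ofFn (funext fun s => ?_))
  simp [List.ofFn_succ, Fin.val_succ]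

/-- Sums over an even-length history, regrouped in consecutive pairs. [folklore] -/
theorem sum_map_pairs_eq_sum {α M : Type*} [AddCommMonoid M] {n : ℕ} (f : Fin (2 * n + 2) → α)
    (g : α → M) :
    ((List.ofFn fun s : Fin (n + 1) =>
        (f ⟨2 * (s : ℕ), by omega⟩, f ⟨2 * (s : ℕ) + 1, by omega⟩)).map fun p => g p.1 + g p.2).sum =
      ∑ t, g (f t) := by
  rw [← List.sum_ofFn (f := fun t => g (f t)), ← Function.comp_def g f, ← List.map_ofFn,
    ofFn_eq_flatten_pairs f, List.map_flatten, List.sum_flatten, List.map_map, List.map_ofFn, List.map_ofFn]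
  congr 1
  refine congrArg List.ofFn (funext fun s => ?_)
  simp

/-- Products over an even-length history of one-body steps, regrouped in consecutive PAIRS (the input
format of `twoState_norm_det_one_add_prod_le_of_isHermitian`). [folklore] -/
theorem prod_ofFn_eq_prod_map_pairs {R α : Type*} [Monoid R] (X : α → R) {n : ℕ} (f : Fin (2 * n + 2) → α) :
    (List.ofFn fun t => X (f t)).prod =
      ((List.ofFn fun s : Fin (n + 1) =>
        (f ⟨2 * (s : ℕ), by omega⟩, f ⟨2 * (s : ℕ) + 1, by omega⟩)).map fun p => X p.1 * X p.2).prod := by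
  rw [← Function.comp_def X f, ← List.map_ofFn, ofFn_eq_flatten_pairs f, List.map_flatten, List.prod_flatten,
    List.map_map, List.map_ofFn, List.map_ofFn]
  congr 1
  refine congrArg List.ofFn (funext fun s => ?_)
  simp

variable {Λ : Type*} [LinearOrder Λ] [Fintype Λ] {L : ℕ} [NeZero L]

/-- A closed history telescopes: `Σ_t (θ_{t+1} - θ_t) = 0` (`t + 1` cyclic). [folklore] -/
theorem sum_sub_cyclic_eq_zero {M : ℕ} [NeZero M] (θ : Fin M → ℝ) : ∑ t, (θ (t + 1) - θ t) = 0 := by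
  rw [Finset.sum_sub_distrib, sub_eq_zero]
  exact Fintype.sum_equiv (Equiv.addRight 1) _ _ fun _ => rfl

/-- **Zero-mode temporal coercivity of the BdG torus reference, at the Fock level (even number of
slices).** For a relabelling `e : Λ ≃ (ℤ/L)²` of the Jordan–Wigner sites, even translation-invariant
hopping `η` and gap data `Δv` with REAL shifted hopping symbol `η̂′` (`η′ = η - μδ₀`), step `a`, the
gauge-fixed one-mode transfer matrices `Ĝ_k = !![Re (G_k)₀₀, ‖(G_k)₁₀‖; ‖(G_k)₁₀‖, Re (G_k)₁₁]`,
`G_k = e^{-a h_k}`, `h_k = !![η̂′ k, Δ̂ k; conj Δ̂ k, -η̂′ k]`, ANY admissible family `0 ≤ κ_k`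
(`…TemporalCoercivity`), and every closed history of GLOBAL pair phases `θ_t`, `t : Fin (2n+2)` cyclic:
`‖Tr ∏_t e^{-aH_BdG(η, e^{iθ_t}Δ, μ)}‖ ≤ |e^{-a(2n+2)|Λ|(η 0 - μ)}| · ∏_k [1 + |det Ĝ_k|^{2(n+1)} + e^{-(κ_k/2) Σ_t (1 - cos(θ_{t+1} - θ_t))} tr (Ĝ_k²)^{n+1}]`
— the FERMIONIC WEIGHT of a zero-mode phase history of the route's reference pays, mode by mode in its
pair sector, `e^{-(κ_k/2)(1 - cos δ)}` for every misalignment `δ` between consecutive time slices,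
uniformly in the number of slices: the temporal half of hypothesis (C) of crux 2R for the reference
weight, in the zero spatial mode, stated on the many-body trace itself. [folklore] -/
theorem norm_trace_prod_gibbsWeight_bdgTorus_phase_le (e : Λ ≃ TorusSite 2 L)
    (η Δv : TorusSite 2 L → ℂ) (hη : ∀ r, η (-r) = η r) (hΔ : ∀ r, Δv (-r) = Δv r) (μ a : ℝ)
    (hreal : ∀ k, star (torusFourier (fun r => η r - if r = 0 then (μ : ℂ) else 0) k) =
      torusFourier (fun r => η r - if r = 0 then (μ : ℂ) else 0) k)
    (Gr : TorusSite 2 L → Matrix (Fin 2) (Fin 2) ℝ)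
    (hGr : ∀ k, Gr k =
      !![(Matrix.gibbsWeight a (!![torusFourier (fun r => η r - if r = 0 then (μ : ℂ) else 0) k,
              torusFourier Δv k; star (torusFourier Δv k),
              -torusFourier (fun r => η r - if r = 0 then (μ : ℂ) else 0) k] : Matrix (Fin 2) (Fin 2) ℂ) 0 0).re,
          ‖Matrix.gibbsWeight a (!![torusFourier (fun r => η r - if r = 0 then (μ : ℂ) else 0) k,
              torusFourier Δv k; star (torusFourier Δv k),
              -torusFourier (fun r => η r - if r = 0 then (μ : ℂ) else 0) k] : Matrix (Fin 2) (Fin 2) ℂ) 1 0‖;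
        ‖Matrix.gibbsWeight a (!![torusFourier (fun r => η r - if r = 0 then (μ : ℂ) else 0) k,
              torusFourier Δv k; star (torusFourier Δv k),
              -torusFourier (fun r => η r - if r = 0 then (μ : ℂ) else 0) k] : Matrix (Fin 2) (Fin 2) ℂ) 1 0‖,
          (Matrix.gibbsWeight a (!![torusFourier (fun r => η r - if r = 0 then (μ : ℂ) else 0) k,
              torusFourier Δv k; star (torusFourier Δv k),
              -torusFourier (fun r => η r - if r = 0 then (μ : ℂ) else 0) k] : Matrix (Fin 2) (Fin 2) ℂ) 1 1).re])
    (κ : TorusSite 2 L → ℝ) (hκ0 : ∀ k, 0 ≤ κ k)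
    (hκ : ∀ k (b b' : Fin 2), κ k * (Gr k b 0 * Gr k 0 b' + Gr k b 1 * Gr k 1 b') ^ 2 ≤
      (Gr k b 0 * Gr k 0 b') * (Gr k b 1 * Gr k 1 b'))
    {n : ℕ} (θ : Fin (2 * n + 2) → ℝ) :
    ‖((List.ofFn fun t => Matrix.gibbsWeight a
        (bdgBondHamiltonian (fun u v => η (e u - e v))
          (fun u v => Complex.exp (Complex.I * θ t) * (-(1 / 2 : ℂ) * star (Δv (e u - e v)))) μ)).prod).trace‖ ≤
      ‖Complex.exp (-(a : ℂ) * ∑ _t : Fin (2 * n + 2), ∑ _x : Λ, (η 0 - μ))‖ *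
        ∏ k : TorusSite 2 L, (1 + |(Gr k).det| ^ (2 * (n + 1)) +
          Real.exp (-(κ k / 2 * ∑ t : Fin (2 * n + 2), (1 - Real.cos (θ (t + 1) - θ t)))) *
            ((Gr k * Gr k) ^ (n + 1)).trace) := by
  rw [trace_prod_gibbsWeight_bdgTorus_phase_eq_prod_modes e η Δv hη hΔ μ a θ, norm_mul, norm_prod]
  refine mul_le_mul_of_nonneg_left (Finset.prod_le_prod (fun k _ => norm_nonneg _) fun k _ => ?_)
    (norm_nonneg _)
  have hh : (!![torusFourier (fun r => η r - if r = 0 then (μ : ℂ) else 0) k, torusFourier Δv k;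
      star (torusFourier Δv k), -torusFourier (fun r => η r - if r = 0 then (μ : ℂ) else 0) k] :
      Matrix (Fin 2) (Fin 2) ℂ).IsHermitian := isHermitian_symbolBlock (hreal k)
  have hG := isHermitian_gibbsWeight a hh
  have hPSD := (posDef_gibbsWeight a hh).posSemidef
  rw [prod_ofFn_eq_prod_map_pairs (fun δ : ℝ => Matrix.gibbsWeight a
      (!![torusFourier (fun r => η r - if r = 0 then (μ : ℂ) else 0) k, torusFourier Δv k;
        star (torusFourier Δv k), -torusFourier (fun r => η r - if r = 0 then (μ : ℂ) else 0) k] :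
        Matrix (Fin 2) (Fin 2) ℂ) *
      diagonal ![Complex.exp (((-(δ / 2) : ℝ) : ℂ) * Complex.I), Complex.exp (((δ / 2 : ℝ) : ℂ) * Complex.I)])
      (fun t : Fin (2 * n + 2) => θ (t + 1) - θ t)]
  have hb := twoState_norm_det_one_add_prod_le_of_isHermitian hG (Complex.nonneg_iff.mp hPSD.diag_nonneg).1
    (Complex.nonneg_iff.mp hPSD.diag_nonneg).1 (Gr k) (hGr k) (hκ0 k) (hκ k)
    (List.ofFn fun s : Fin (n + 1) =>
      (θ (⟨2 * (s : ℕ), by omega⟩ + 1) - θ ⟨2 * (s : ℕ), by omega⟩,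
        θ (⟨2 * (s : ℕ) + 1, by omega⟩ + 1) - θ ⟨2 * (s : ℕ) + 1, by omega⟩))
    (by rw [sum_map_pairs_eq_sum (fun t : Fin (2 * n + 2) => θ (t + 1) - θ t) (fun x => x)]; exact sum_sub_cyclic_eq_zero θ)
  rw [List.length_ofFn, sum_map_pairs_eq_sum (fun t : Fin (2 * n + 2) => θ (t + 1) - θ t)
    (fun δ => 1 - Real.cos δ)] at hb
  exact hb

/-- For a Hermitian `2 × 2` matrix the gauge-fixed real form `!![Re G₀₀, ‖G₁₀‖; ‖G₁₀‖, Re G₁₁]` has the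
same determinant. [folklore] -/
theorem det_gaugeFix_eq {G : Matrix (Fin 2) (Fin 2) ℂ} (hG : G.IsHermitian) :
    (((!![(G 0 0).re, ‖G 1 0‖; ‖G 1 0‖, (G 1 1).re] : Matrix (Fin 2) (Fin 2) ℝ).det : ℝ) : ℂ) = G.det := by
  have h00 : ((G 0 0).re : ℂ) = G 0 0 := Complex.conj_eq_iff_re.mp (hG.apply 0 0)
  have h11 : ((G 1 1).re : ℂ) = G 1 1 := Complex.conj_eq_iff_re.mp (hG.apply 1 1)
  have h01 : G 0 1 * G 1 0 = ((‖G 1 0‖ : ℝ) : ℂ) * ((‖G 1 0‖ : ℝ) : ℂ) := by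
    rw [← hG.apply 0 1, Complex.star_def, Complex.conj_mul', sq]
  rw [Matrix.det_fin_two, Matrix.det_fin_two, h01]
  simp only [Matrix.of_apply, Matrix.cons_val', Matrix.cons_val_zero, Matrix.cons_val_one,
    Matrix.empty_val', Matrix.cons_val_fin_one]
  push_cast
  rw [h00, h11]

/-- `det e^{-a h} = 1` for every symbol block `h = !![ξ, D; conj D, -ξ]` (also the degenerate one).
[folklore] -/
theorem det_gibbsWeight_symbolBlock_eq_one (ξ : ℝ) (D : ℂ) (a : ℝ) :
    (Matrix.gibbsWeight a (!![(ξ : ℂ), D; star D, -(ξ : ℂ)] : Matrix (Fin 2) (Fin 2) ℂ)).det = 1 := by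
  by_cases hE : ξ ^ 2 + ‖D‖ ^ 2 = 0
  · have hξ : ξ = 0 := by nlinarith [sq_nonneg ξ, sq_nonneg ‖D‖]
    have hD : D = 0 := norm_eq_zero.mp (by nlinarith [sq_nonneg ξ, sq_nonneg ‖D‖, norm_nonneg D])
    subst hξ hD
    have h0 : (!![((0 : ℝ) : ℂ), 0; star 0, -((0 : ℝ) : ℂ)] : Matrix (Fin 2) (Fin 2) ℂ) = 0 := by
      ext i j
      fin_cases i <;> fin_cases j <;> simp
    rw [h0, Matrix.gibbsWeight, smul_zero, NormedSpace.exp_zero, det_one]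
  · exact det_gibbsWeight_symbolBlock ξ D a hE

/-- **Zero-mode temporal coercivity at the Fock level, explicit constants.** In the setting of
`norm_trace_prod_gibbsWeight_bdgTorus_phase_le` with `a ≠ 0` there is ONE family `κ_k ≥ 0`, strictly
positive at every mode off the nodes of the gap symbol (`Δ̂ k ≠ 0`) and independent of the number of
slices and of the history, with
`‖Tr ∏_t e^{-aH_BdG(η, e^{iθ_t}Δ, μ)}‖ ≤ |e^{-a(2n+2)|Λ|(η 0 - μ)}| · ∏_k [2 + e^{-(κ_k/2) Σ_t (1 - cos(θ_{t+1} - θ_t))} tr (Ĝ_k²)^{n+1}]`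
(`det Ĝ_k = det e^{-ah_k} = 1`: the phase-blind part of each mode is its empty/broken-pair sector `2`).
[folklore] -/
theorem exists_coercive_norm_trace_prod_gibbsWeight_bdgTorus_phase_le (e : Λ ≃ TorusSite 2 L)
    (η Δv : TorusSite 2 L → ℂ) (hη : ∀ r, η (-r) = η r) (hΔ : ∀ r, Δv (-r) = Δv r) (μ : ℝ) {a : ℝ}
    (ha : a ≠ 0)
    (hreal : ∀ k, star (torusFourier (fun r => η r - if r = 0 then (μ : ℂ) else 0) k) =
      torusFourier (fun r => η r - if r = 0 then (μ : ℂ) else 0) k) :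
    ∃ κ : TorusSite 2 L → ℝ, (∀ k, 0 ≤ κ k) ∧ (∀ k, torusFourier Δv k ≠ 0 → 0 < κ k) ∧
      ∀ (n : ℕ) (θ : Fin (2 * n + 2) → ℝ),
        ‖((List.ofFn fun t => Matrix.gibbsWeight a
            (bdgBondHamiltonian (fun u v => η (e u - e v))
              (fun u v => Complex.exp (Complex.I * θ t) * (-(1 / 2 : ℂ) * star (Δv (e u - e v)))) μ)).prod).trace‖ ≤
          ‖Complex.exp (-(a : ℂ) * ∑ _t : Fin (2 * n + 2), ∑ _x : Λ, (η 0 - μ))‖ *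
            ∏ k : TorusSite 2 L, (2 +
              Real.exp (-(κ k / 2 * ∑ t : Fin (2 * n + 2), (1 - Real.cos (θ (t + 1) - θ t)))) *
                (((!![(Matrix.gibbsWeight a (!![torusFourier (fun r => η r - if r = 0 then (μ : ℂ) else 0) k,
                        torusFourier Δv k; star (torusFourier Δv k),
                        -torusFourier (fun r => η r - if r = 0 then (μ : ℂ) else 0) k] : Matrix (Fin 2) (Fin 2) ℂ) 0 0).re,
                      ‖Matrix.gibbsWeight a (!![torusFourier (fun r => η r - if r = 0 then (μ : ℂ) else 0) k,
                        torusFourier Δv k; star (torusFourier Δv k),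
                        -torusFourier (fun r => η r - if r = 0 then (μ : ℂ) else 0) k] : Matrix (Fin 2) (Fin 2) ℂ) 1 0‖;
                    ‖Matrix.gibbsWeight a (!![torusFourier (fun r => η r - if r = 0 then (μ : ℂ) else 0) k,
                        torusFourier Δv k; star (torusFourier Δv k),
                        -torusFourier (fun r => η r - if r = 0 then (μ : ℂ) else 0) k] : Matrix (Fin 2) (Fin 2) ℂ) 1 0‖,
                      (Matrix.gibbsWeight a (!![torusFourier (fun r => η r - if r = 0 then (μ : ℂ) else 0) k,
                        torusFourier Δv k; star (torusFourier Δv k),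
                        -torusFourier (fun r => η r - if r = 0 then (μ : ℂ) else 0) k] : Matrix (Fin 2) (Fin 2) ℂ) 1 1).re] :
                    Matrix (Fin 2) (Fin 2) ℝ) *
                  !![(Matrix.gibbsWeight a (!![torusFourier (fun r => η r - if r = 0 then (μ : ℂ) else 0) k,
                        torusFourier Δv k; star (torusFourier Δv k),
                        -torusFourier (fun r => η r - if r = 0 then (μ : ℂ) else 0) k] : Matrix (Fin 2) (Fin 2) ℂ) 0 0).re,
                      ‖Matrix.gibbsWeight a (!![torusFourier (fun r => η r - if r = 0 then (μ : ℂ) else 0) k,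
                        torusFourier Δv k; star (torusFourier Δv k),
                        -torusFourier (fun r => η r - if r = 0 then (μ : ℂ) else 0) k] : Matrix (Fin 2) (Fin 2) ℂ) 1 0‖;
                    ‖Matrix.gibbsWeight a (!![torusFourier (fun r => η r - if r = 0 then (μ : ℂ) else 0) k,
                        torusFourier Δv k; star (torusFourier Δv k),
                        -torusFourier (fun r => η r - if r = 0 then (μ : ℂ) else 0) k] : Matrix (Fin 2) (Fin 2) ℂ) 1 0‖,
                      (Matrix.gibbsWeight a (!![torusFourier (fun r => η r - if r = 0 then (μ : ℂ) else 0) k,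
                        torusFourier Δv k; star (torusFourier Δv k),
                        -torusFourier (fun r => η r - if r = 0 then (μ : ℂ) else 0) k] : Matrix (Fin 2) (Fin 2) ℂ) 1 1).re]) ^
                  (n + 1)).trace) := by
  -- the shifted hopping symbol is real: write it as `↑(ξ k)`
  set ξ : TorusSite 2 L → ℝ := fun k => (torusFourier (fun r => η r - if r = 0 then (μ : ℂ) else 0) k).re
  have hξ : ∀ k, ((ξ k : ℝ) : ℂ) = torusFourier (fun r => η r - if r = 0 then (μ : ℂ) else 0) k := fun k =>
    Complex.conj_eq_iff_re.mp (hreal k)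
  have hh : ∀ k, (!![torusFourier (fun r => η r - if r = 0 then (μ : ℂ) else 0) k, torusFourier Δv k;
      star (torusFourier Δv k), -torusFourier (fun r => η r - if r = 0 then (μ : ℂ) else 0) k] :
      Matrix (Fin 2) (Fin 2) ℂ).IsHermitian := fun k => isHermitian_symbolBlock (hreal k)
  obtain ⟨κ, hκ0, hκpos, hκ⟩ := exists_admissible_family_symbolBlock ξ (fun k => torusFourier Δv k) ha
    (fun k => !![(Matrix.gibbsWeight a (!![torusFourier (fun r => η r - if r = 0 then (μ : ℂ) else 0) k,
          torusFourier Δv k; star (torusFourier Δv k),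
          -torusFourier (fun r => η r - if r = 0 then (μ : ℂ) else 0) k] : Matrix (Fin 2) (Fin 2) ℂ) 0 0).re,
        ‖Matrix.gibbsWeight a (!![torusFourier (fun r => η r - if r = 0 then (μ : ℂ) else 0) k,
          torusFourier Δv k; star (torusFourier Δv k),
          -torusFourier (fun r => η r - if r = 0 then (μ : ℂ) else 0) k] : Matrix (Fin 2) (Fin 2) ℂ) 1 0‖;
      ‖Matrix.gibbsWeight a (!![torusFourier (fun r => η r - if r = 0 then (μ : ℂ) else 0) k,
          torusFourier Δv k; star (torusFourier Δv k),
          -torusFourier (fun r => η r - if r = 0 then (μ : ℂ) else 0) k] : Matrix (Fin 2) (Fin 2) ℂ) 1 0‖,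
        (Matrix.gibbsWeight a (!![torusFourier (fun r => η r - if r = 0 then (μ : ℂ) else 0) k,
          torusFourier Δv k; star (torusFourier Δv k),
          -torusFourier (fun r => η r - if r = 0 then (μ : ℂ) else 0) k] : Matrix (Fin 2) (Fin 2) ℂ) 1 1).re])
    (fun k => by rw [hξ k])
  refine ⟨κ, hκ0, hκpos, fun n θ => ?_⟩
  have hdet : ∀ k, (!![(Matrix.gibbsWeight a (!![torusFourier (fun r => η r - if r = 0 then (μ : ℂ) else 0) k,
          torusFourier Δv k; star (torusFourier Δv k),
          -torusFourier (fun r => η r - if r = 0 then (μ : ℂ) else 0) k] : Matrix (Fin 2) (Fin 2) ℂ) 0 0).re,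
        ‖Matrix.gibbsWeight a (!![torusFourier (fun r => η r - if r = 0 then (μ : ℂ) else 0) k,
          torusFourier Δv k; star (torusFourier Δv k),
          -torusFourier (fun r => η r - if r = 0 then (μ : ℂ) else 0) k] : Matrix (Fin 2) (Fin 2) ℂ) 1 0‖;
      ‖Matrix.gibbsWeight a (!![torusFourier (fun r => η r - if r = 0 then (μ : ℂ) else 0) k,
          torusFourier Δv k; star (torusFourier Δv k),
          -torusFourier (fun r => η r - if r = 0 then (μ : ℂ) else 0) k] : Matrix (Fin 2) (Fin 2) ℂ) 1 0‖,
        (Matrix.gibbsWeight a (!![torusFourier (fun r => η r - if r = 0 then (μ : ℂ) else 0) k,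
          torusFourier Δv k; star (torusFourier Δv k),
          -torusFourier (fun r => η r - if r = 0 then (μ : ℂ) else 0) k] : Matrix (Fin 2) (Fin 2) ℂ) 1 1).re] :
        Matrix (Fin 2) (Fin 2) ℝ).det = 1 := fun k => by
    have h1 := det_gaugeFix_eq (isHermitian_gibbsWeight a (hh k))
    have h2 : (Matrix.gibbsWeight a (!![torusFourier (fun r => η r - if r = 0 then (μ : ℂ) else 0) k,
        torusFourier Δv k; star (torusFourier Δv k),
        -torusFourier (fun r => η r - if r = 0 then (μ : ℂ) else 0) k] : Matrix (Fin 2) (Fin 2) ℂ)).det = 1 := by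
      rw [← hξ k]
      exact det_gibbsWeight_symbolBlock_eq_one (ξ k) (torusFourier Δv k) a
    rw [h2] at h1
    exact_mod_cast h1
  refine (norm_trace_prod_gibbsWeight_bdgTorus_phase_le e η Δv hη hΔ μ a hreal _ (fun k => rfl) κ hκ0 hκ
    θ).trans_eq ?_
  congr 1
  refine Finset.prod_congr rfl fun k _ => ?_
  rw [hdet k, abs_one, one_pow, one_add_one_eq_two]

end ZeroModeCoercivity

end BirBdG

end Summit.HubbardSuperconductivity.HubbardSuperconductivity.Theorems
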